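import Literature.NumberTheory.EllipticCurves.KimNakamura2020.RankZeroShaBound
import Literature.NumberTheory.EllipticCurves.TorsionCardinality
import Mathlib.NumberTheory.Padics.RingHoms
import HarnessLib

/-!
# Kim–Nakamura's "exceptional case" at `p = 5` IS the `5`-division polynomial: off `a₄ ≡ 10 (mod 25)`
# no point of `E₀(ℚ₅) ∖ E₁(ℚ₅)` is killed by `5` (theorems only; `p = 5` twin of
# `NonExceptionalThreeTorsionProofs.lean`)

Topic `NumberTheory/EllipticCurves`, sub-directory `KimNakamura2020`. THEOREMS ONLY — no definition,
no named fact, no `sorry`; net named-fact debt `0`. Written by the literature seat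
bsd-potss-conjA-anchor-g25 (cell `pub/bsd-potss/`) as the kernel form, at `p = 5`, of the local
clause "`E(ℚ₅)[5] = 0` off the Kosters–Pannekoek exceptional congruence" that the Selmer-trivial /
decomposition-fixed road to Coates–Sujatha Conjecture A carries as a displayed binder at the one place
`v ∣ 5` of additive (potentially good) reduction; it is the `p = 5` companion of bsd-cited-r10's
`NonExceptionalThreeTorsionProofs.lean` and follows that file's architecture line by line.

## What and why

On a model (2.1) of Kim–Nakamura (arXiv:1808.07726 p. 5: all `aᵢ ∈ pℤ_p`, which exists exactly when
the reduction at `p` is additive) the reduced curve is the cuspidal cubic `ȳ² = x̄³`, the points of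
`E₀(ℚ_p) ∖ E₁(ℚ_p)` are the `(x, y)` with `x ∈ ℤ_pˣ`, `y ∈ ℤ_p`, and Kim–Nakamura's Assumption 2.5 —
Kosters–Pannekoek's exceptional case (arXiv:1703.07888, Cor. 2; C.-H. Kim, arXiv:2203.12159, Prop.
3.2) — reads at `p = 5`: `a₄ ≡ 10 (mod 25)`. Kosters–Pannekoek prove (Cor. 2, `K = ℚ_p`) that
`E₀(ℚ_p)` has a point of order `p` iff the model is exceptional. This file proves the direction
"not exceptional ⇒ no point of `E₀(ℚ₅) ∖ E₁(ℚ₅)` is killed by `5`" in the kernel, by the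
`5`-division polynomial: `[5]P = O ⟺ ψ₅(x(P)) = 0` (Silverman *AEC* Exercise 3.7 (f), tree theorem
`WeierstrassCurve.zsmul_some_eq_zero_iff_eval_ΨSq` with Mathlib's `ΨSq 5 = (preΨ' 5)²`), the closed
form `ψ₅ = preΨ₄ · Ψ₂Sq² − Ψ₃³ = 5x¹² + 5b₂x¹¹ + (31b₄ + b₂²)x¹⁰ + ⋯` (`eval_preΨ'_five`, `51` monomials
in Mathlib's `b₂, b₄, b₆, b₈`), and the observation that on a (2.1)-model (`b₂, b₄, b₆ ∈ 5R`,
`b₈ ∈ 25R`) `ψ₅(x) = 5x¹² + b₄x¹⁰ + 25·G` with `G` integral (`exists_eval_preΨ'_five_eq_of_b`), while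
the curve equation mod `5` (`ȳ² = x̄³`, `x̄ ≠ 0`, so `x̄ ∈ {1, 4}` is a non-zero square of `𝔽₅` and
`x¹⁰ ≡ 1`, `5x¹² ≡ 5 (mod 25)`) gives `ψ₅(x) ≡ 5 + b₄ = 5(1 + 2·(a₄/5)) (mod 25)`, which vanishes iff
`a₄ ≡ 10 (mod 25)`. The mod-`25` bookkeeping is two decidable statements over `ZMod 25`
(`zmod_25_core`, `5⁴` cases; `zmod_25_lin`, `25` cases), reached through `PadicInt.toZModPow 2`.

## Results

* `preΨ'_five`, `eval_preΨ'_five` — `ψ₅ = preΨ₄·Ψ₂Sq² − Ψ₃³` and its closed form in `b₂, b₄, b₆, b₈`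
  over any commutative ring (Silverman *AEC* Exercise 3.7).
* `exists_eval_preΨ'_five_eq_of_b`, `exists_eval_preΨ'_five_eq_of_coeff_eq_five_mul` — on a model with
  `b₂ = 5B₂, b₄ = 5B₄, b₆ = 5B₆, b₈ = 25B₈` (in particular `aᵢ = 5cᵢ`): `ψ₅(x) = 5x¹² + 5B₄x¹⁰ + 25G`.
* `eval_preΨ'_five_ne_zero_of_isUnit_five` — for `V/ℚ₅` with `aᵢ = 5cᵢ` (`cᵢ ∈ ℤ`), `¬ 5 ∣ c₄ − 2`,
  and an affine point `(x, y)` of `V` with `x ∈ ℤ₅ˣ`, `y ∈ ℤ₅`: `ψ₅(x) ≠ 0`.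
* `five_nsmul_ne_zero_of_isUnit_five` — such a point has `5 • P ≠ O`.
* `nonExceptional_five_iff`, `nonExceptional_five_of_translate` — the `p = 5` unfolding of the fact
  file's predicate `NonExceptional W p` and its certificate constructor (closed rational identities,
  `norm_num` on a concrete curve), twins of `nonExceptional_three_iff` / `…_of_translate`.
* `exists_model_five_nsmul_ne_zero_of_nonExceptional_five` — from `NonExceptional W 5` (`W/ℚ`): a
  `u = 1` translate `C • W` whose base change to `ℚ₅` has the property.
Only the direction consumers need is proved; that `a₄ ≡ 10 (mod 25)` does produce `5`-torsion in
`E₀(ℚ₅)` (Kosters–Pannekoek Cor. 2, "⇒") is used by no consumer and is not formalised.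

HONEST FRAMING: this is the `E₀ ∖ E₁` clause only. The full local statement `E(ℚ₅)[5] = 0` for a
globally minimal `W/ℚ` with additive reduction at `5` needs in addition `E₁(ℚ₅)` torsion-free
(Silverman *AEC* VII.3.4 / IV.6.1 at `p = 5 ≥ 3`) and `[E(ℚ₅) : E₀(ℚ₅)] = c₅ ≤ 4` (Kodaira–Néron);
those are separate tree theorems and are not restated here. Typed ≠ proved ≠ endorsed; nothing is
booked by this file.

## References

* C.-H. Kim, K. Nakamura, J. Number Theory 210 (2020) 249–279 = arXiv:1808.07726: (2.1), Thm 2.1,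
  Assumption 2.5 (arXiv p. 5). [KimNakamura2020]
* M. Kosters, R. Pannekoek, arXiv:1703.07888, Thm. 1, Cor. 2 (arXiv p. 3): on a minimal model with
  `p ∣ aᵢ`, `E₀(ℚ_p)[p] ≠ 0` iff `p = 5 ∧ a₄ ≡ 10 (mod 25)` (resp. `p = 2, 3, 7` analogues). [KostersPannekoek2017]
* C.-H. Kim, *The structure of Selmer groups and the Iwasawa main conjecture for elliptic curves*,
  arXiv:2203.12159, Prop. 3.2 (arXiv p. 15). [Kim2022StructureSelmer]
* J. H. Silverman, *The Arithmetic of Elliptic Curves*, GTM 106 (2nd ed.), Exercise 3.7 (`ψ₅`),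
  III.1 (`b₂, b₄, b₆, b₈`). [SilvermanAEC2009]
-/

noncomputable section

open scoped Classical

open Polynomial

namespace Literature.NumberTheory.EllipticCurves.KimNakamura2020

/-! ## §1 The `5`-division polynomial and its shape on a (2.1)-model -/

/-- **`ψ₅ = preΨ₄ · Ψ₂Sq² − Ψ₃³`** (Mathlib's `preΨ' 5`, the odd recursion at `m = 0`). The same
identity is `Summit.BirchSwinnertonDyer.Rank1Residual.Additive.KernelPolyLine.preΨ'_five_eq`
(`Summits/…/Additive/X3LineDatumOfKernelPolyCert.lean`), which a Literature file cannot import; restated.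
[cite: SilvermanAEC2009, Exercise 3.7 (a)] -/
theorem preΨ'_five {R : Type*} [CommRing R] (V : WeierstrassCurve R) :
    V.preΨ' 5 = V.preΨ₄ * V.Ψ₂Sq ^ 2 - V.Ψ₃ ^ 3 := by
  rw [show 5 = 2 * (0 + 2) + 1 by rfl, WeierstrassCurve.preΨ'_odd, WeierstrassCurve.preΨ'_four,
    WeierstrassCurve.preΨ'_two, if_pos Even.zero, WeierstrassCurve.preΨ'_one,
    WeierstrassCurve.preΨ'_three, if_pos Even.zero]
  ring

/-- **The `5`-division polynomial in closed form**: `ψ₅(x) = 5x¹² + 5b₂x¹¹ + (31b₄ + b₂²)x¹⁰ + ⋯`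
(`51` monomials in Mathlib's `b₂, b₄, b₆, b₈`; for `y² = x³ + Ax + B` this is the classical
`5x¹² + 62Ax¹⁰ + 380Bx⁹ − 105A²x⁸ + ⋯`). [cite: SilvermanAEC2009, Exercise 3.7] -/
theorem eval_preΨ'_five {R : Type*} [CommRing R] (V : WeierstrassCurve R) (x : R) :
    (V.preΨ' 5).eval x =
      5 * x ^ 12 + 5 * V.b₂ * x ^ 11 + 31 * V.b₄ * x ^ 10 + V.b₂ ^ 2 * x ^ 10 + 95 * V.b₆ * x ^
      9 + 10 * V.b₂ * V.b₄ * x ^ 9 + 133 * V.b₈ * x ^ 8 + 7 * V.b₄ ^ 2 * x ^ 8 + 38 * V.b₂ *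
      V.b₆ * x ^ 8 + 30 * V.b₄ * V.b₆ * x ^ 7 + 78 * V.b₂ * V.b₈ * x ^ 7 - 3 * V.b₂ * V.b₄ ^ 2
      * x ^ 7 + 3 * V.b₂ ^ 2 * V.b₆ * x ^ 7 - 15 * V.b₆ ^ 2 * x ^ 6 + 122 * V.b₄ * V.b₈ * x ^ 6
      - 7 * V.b₄ ^ 3 * x ^ 6 - 8 * V.b₂ * V.b₄ * V.b₆ * x ^ 6 + 15 * V.b₂ ^ 2 * V.b₈ * x ^ 6 +
      26 * V.b₆ * V.b₈ * x ^ 5 - 37 * V.b₄ ^ 2 * V.b₆ * x ^ 5 - 14 * V.b₂ * V.b₆ ^ 2 * x ^ 5 +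
      46 * V.b₂ * V.b₄ * V.b₈ * x ^ 5 - V.b₂ ^ 2 * V.b₄ * V.b₆ * x ^ 5 + V.b₂ ^ 3 * V.b₈ * x ^
      5 - 9 * V.b₈ ^ 2 * x ^ 4 - 60 * V.b₄ * V.b₆ ^ 2 * x ^ 4 + 29 * V.b₄ ^ 2 * V.b₈ * x ^ 4 +
      10 * V.b₂ * V.b₆ * V.b₈ * x ^ 4 - 4 * V.b₂ * V.b₄ ^ 2 * V.b₆ * x ^ 4 - V.b₂ ^ 2 * V.b₆ ^
      2 * x ^ 4 + 5 * V.b₂ ^ 2 * V.b₄ * V.b₈ * x ^ 4 - 25 * V.b₆ ^ 3 * x ^ 3 - 6 * V.b₄ * V.b₆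
      * V.b₈ * x ^ 3 - 4 * V.b₄ ^ 3 * V.b₆ * x ^ 3 - 3 * V.b₂ * V.b₈ ^ 2 * x ^ 3 - 6 * V.b₂ *
      V.b₄ * V.b₆ ^ 2 * x ^ 3 + 8 * V.b₂ * V.b₄ ^ 2 * V.b₈ * x ^ 3 + 2 * V.b₂ ^ 2 * V.b₆ * V.b₈
      * x ^ 3 - 17 * V.b₆ ^ 2 * V.b₈ * x ^ 2 - 9 * V.b₄ * V.b₈ ^ 2 * x ^ 2 - 8 * V.b₄ ^ 2 *
      V.b₆ ^ 2 * x ^ 2 + 4 * V.b₄ ^ 3 * V.b₈ * x ^ 2 - 2 * V.b₂ * V.b₆ ^ 3 * x ^ 2 + 6 * V.b₂ *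
      V.b₄ * V.b₆ * V.b₈ * x ^ 2 - 9 * V.b₆ * V.b₈ ^ 2 * x - 5 * V.b₄ * V.b₆ ^ 3 * x + 4 * V.b₄
      ^ 2 * V.b₆ * V.b₈ * x + V.b₂ * V.b₆ ^ 2 * V.b₈ * x - V.b₈ ^ 3 - V.b₆ ^ 4 + V.b₄ * V.b₆ ^
      2 * V.b₈ := by
  rw [preΨ'_five]
  simp only [WeierstrassCurve.Ψ₂Sq, WeierstrassCurve.Ψ₃, WeierstrassCurve.preΨ₄, eval_add, eval_sub,
    eval_mul, eval_pow, eval_C, eval_X, eval_ofNat]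
  ring

/-- **`ψ₅` on a model with `b₂, b₄, b₆ ∈ 5R`, `b₈ ∈ 25R`** (e.g. all `aᵢ ∈ 5R`):
`ψ₅(x) = 5x¹² + 5B₄x¹⁰ + 25·G` for an explicit `G ∈ ℤ[B₂, B₄, B₆, B₈, x]` (`50` monomials, given in
the proof), where `b₄ = 5B₄`. [cite: SilvermanAEC2009, Exercise 3.7]
[cite: KostersPannekoek2017, Cor. 2 (the congruence `a₄ ≡ 10 (mod 25)` at `p = 5`)] -/
theorem exists_eval_preΨ'_five_eq_of_b {R : Type*} [CommRing R] (V : WeierstrassCurve R)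
    {B₂ B₄ B₆ B₈ : R} (h₂ : V.b₂ = 5 * B₂) (h₄ : V.b₄ = 5 * B₄) (h₆ : V.b₆ = 5 * B₆)
    (h₈ : V.b₈ = 25 * B₈) (x : R) :
    ∃ G : R, (V.preΨ' 5).eval x = 5 * x ^ 12 + 5 * B₄ * x ^ 10 + 25 * G :=
  ⟨B₂ * x ^ 11 + 6 * B₄ * x ^ 10 + B₂ ^ 2 * x ^ 10 + 19 * B₆ * x ^ 9 + 10 * B₂ * B₄ * x ^ 9
      + 133 * B₈ * x ^ 8 + 7 * B₄ ^ 2 * x ^ 8 + 38 * B₂ * B₆ * x ^ 8 + 30 * B₄ * B₆ * x ^ 7 +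
      390 * B₂ * B₈ * x ^ 7 - 15 * B₂ * B₄ ^ 2 * x ^ 7 + 15 * B₂ ^ 2 * B₆ * x ^ 7 - 15 * B₆ ^ 2
      * x ^ 6 + 610 * B₄ * B₈ * x ^ 6 - 35 * B₄ ^ 3 * x ^ 6 - 40 * B₂ * B₄ * B₆ * x ^ 6 + 375 *
      B₂ ^ 2 * B₈ * x ^ 6 + 130 * B₆ * B₈ * x ^ 5 - 185 * B₄ ^ 2 * B₆ * x ^ 5 - 70 * B₂ * B₆ ^
      2 * x ^ 5 + 1150 * B₂ * B₄ * B₈ * x ^ 5 - 25 * B₂ ^ 2 * B₄ * B₆ * x ^ 5 + 125 * B₂ ^ 3 *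
      B₈ * x ^ 5 - 225 * B₈ ^ 2 * x ^ 4 - 300 * B₄ * B₆ ^ 2 * x ^ 4 + 725 * B₄ ^ 2 * B₈ * x ^ 4
      + 250 * B₂ * B₆ * B₈ * x ^ 4 - 100 * B₂ * B₄ ^ 2 * B₆ * x ^ 4 - 25 * B₂ ^ 2 * B₆ ^ 2 * x
      ^ 4 + 625 * B₂ ^ 2 * B₄ * B₈ * x ^ 4 - 125 * B₆ ^ 3 * x ^ 3 - 150 * B₄ * B₆ * B₈ * x ^ 3
      - 100 * B₄ ^ 3 * B₆ * x ^ 3 - 375 * B₂ * B₈ ^ 2 * x ^ 3 - 150 * B₂ * B₄ * B₆ ^ 2 * x ^ 3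
      + 1000 * B₂ * B₄ ^ 2 * B₈ * x ^ 3 + 250 * B₂ ^ 2 * B₆ * B₈ * x ^ 3 - 425 * B₆ ^ 2 * B₈ *
      x ^ 2 - 1125 * B₄ * B₈ ^ 2 * x ^ 2 - 200 * B₄ ^ 2 * B₆ ^ 2 * x ^ 2 + 500 * B₄ ^ 3 * B₈ *
      x ^ 2 - 50 * B₂ * B₆ ^ 3 * x ^ 2 + 750 * B₂ * B₄ * B₆ * B₈ * x ^ 2 - 1125 * B₆ * B₈ ^ 2 *
      x - 125 * B₄ * B₆ ^ 3 * x + 500 * B₄ ^ 2 * B₆ * B₈ * x + 125 * B₂ * B₆ ^ 2 * B₈ * x - 625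
      * B₈ ^ 3 - 25 * B₆ ^ 4 + 125 * B₄ * B₆ ^ 2 * B₈, by
    rw [eval_preΨ'_five, h₂, h₄, h₆, h₈]
    ring⟩

/-- **`ψ₅` on a (2.1)-model `aᵢ = 5cᵢ`**: then `b₂ = 5(5c₁² + 4c₂)`, `b₄ = 5(2c₄ + 5c₁c₃)`,
`b₆ = 5(5c₃² + 4c₆)`, `b₈ = 25(5c₁²c₆ + 4c₂c₆ − 5c₁c₃c₄ + 5c₂c₃² − c₄²)`, so
`ψ₅(x) = 5x¹² + 5(2c₄ + 5c₁c₃)x¹⁰ + 25·G`. [cite: SilvermanAEC2009, Exercise 3.7 and III.1]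
[cite: KimNakamura2020, (2.1) (arXiv p. 5)] -/
theorem exists_eval_preΨ'_five_eq_of_coeff_eq_five_mul {R : Type*} [CommRing R]
    (V : WeierstrassCurve R) {c₁ c₂ c₃ c₄ c₆ : R} (h₁ : V.a₁ = 5 * c₁) (h₂ : V.a₂ = 5 * c₂)
    (h₃ : V.a₃ = 5 * c₃) (h₄ : V.a₄ = 5 * c₄) (h₆ : V.a₆ = 5 * c₆) (x : R) :
    ∃ G : R, (V.preΨ' 5).eval x = 5 * x ^ 12 + 5 * (2 * c₄ + 5 * c₁ * c₃) * x ^ 10 + 25 * G :=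
  exists_eval_preΨ'_five_eq_of_b V (B₂ := 5 * c₁ ^ 2 + 4 * c₂) (B₆ := 5 * c₃ ^ 2 + 4 * c₆)
    (B₈ := 5 * c₁ ^ 2 * c₆ + 4 * c₂ * c₆ - 5 * c₁ * c₃ * c₄ + 5 * c₂ * c₃ ^ 2 - c₄ ^ 2)
    (by rw [WeierstrassCurve.b₂, h₁, h₂]; ring) (by rw [WeierstrassCurve.b₄, h₁, h₃, h₄]; ring)
    (by rw [WeierstrassCurve.b₆, h₃, h₆]; ring)
    (by rw [WeierstrassCurve.b₈, h₁, h₂, h₃, h₄, h₆]; ring) x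

/-- The mod-`25` content of Assumption 2.5 at `p = 5`, part 1: for residues `z = x̄`, `w = ȳ` with
`ȳ² ≡ x̄³ (mod 5)` and `5 ∤ x`, `x̄ (mod 5) ∈ {1, 4}` is a non-zero square, so `5x¹² ≡ 5x¹⁰ ≡ 5
(mod 25)`. One decidable statement (`5⁴` cases); private plumbing. [folklore] -/
private theorem zmod_25_core : ∀ z w : ZMod (5 ^ 2), 5 * (w ^ 2 - z ^ 3) = 0 → 5 * z ≠ 0 →
    5 * z ^ 12 = 5 ∧ 5 * z ^ 10 = 5 := by
  decide

/-- The mod-`25` content of Assumption 2.5 at `p = 5`, part 2: `5 + 10c = 0` in `ℤ/25ℤ` says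
`c ≡ 2 (mod 5)`. (`25` cases); private plumbing. [folklore] -/
private theorem zmod_25_lin : ∀ c : ZMod (5 ^ 2), 5 + 10 * c = 0 → 5 * (c - 2) = 0 := by
  decide

/-- A `5`-adic unit stays a non-zero-divisor of `5` modulo `25`: `5·x̄ ≠ 0` in `ℤ/25ℤ`; private
plumbing. [folklore] -/
private theorem five_mul_toZModPow_two_ne_zero {x : ℤ_[5]} (hx : IsUnit x) :
    5 * PadicInt.toZModPow 2 x ≠ 0 := by
  obtain ⟨u, rfl⟩ := hx
  intro h
  have h1 : PadicInt.toZModPow 2 (u : ℤ_[5]) * PadicInt.toZModPow 2 (↑u⁻¹ : ℤ_[5]) = 1 := by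
    rw [← map_mul, Units.mul_inv, map_one]
  have h5 : (5 : ZMod (5 ^ 2)) = 0 := by
    calc (5 : ZMod (5 ^ 2))
        = 5 * (PadicInt.toZModPow 2 (u : ℤ_[5]) * PadicInt.toZModPow 2 (↑u⁻¹ : ℤ_[5])) := by
          rw [h1, mul_one]
      _ = 0 := by rw [← mul_assoc, h, zero_mul]
  exact absurd h5 (by decide)

/-! ## §2 No point of `E₀(ℚ₅) ∖ E₁(ℚ₅)` is killed by `5` off the exceptional case -/

section Local

variable (V : WeierstrassCurve ℚ_[5]) {c₁ c₂ c₃ c₄ c₆ : ℤ}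

/-- **Kim–Nakamura Assumption 2.5 read through `ψ₅`, `p = 5`, `K = ℚ₅`.** Let `V/ℚ₅` have
`aᵢ = 5cᵢ` with `cᵢ ∈ ℤ` (a model (2.1)) and `c₄ ≢ 2 (mod 5)` (i.e. `a₄ ≢ 10 (mod 25)`: NOT the
exceptional case). Then for every point `(x, y)` of `V` with `x ∈ ℤ₅ˣ` and `y ∈ ℤ₅` — the points of
`E₀(ℚ₅) ∖ E₁(ℚ₅)` of this cuspidal model — `ψ₅(x) ≠ 0`. Proof: `ψ₅(x) = 5x¹² + 5(2c₄ + 5c₁c₃)x¹⁰ +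
25G` on the integral model, the equation mod `5` reads `ȳ² = x̄³` with `x̄ ≠ 0`, and `zmod_25_core`,
`zmod_25_lin`. [cite: KimNakamura2020, Assumption 2.5 with (2.1) (arXiv p. 5)]
[cite: KostersPannekoek2017, Cor. 2 (direction "not exceptional ⇒ no `p`-torsion in `E₀`", `K = ℚ₅`)]
[cite: SilvermanAEC2009, Exercise 3.7] -/
theorem eval_preΨ'_five_ne_zero_of_isUnit_five (h₁ : V.a₁ = 5 * c₁) (h₂ : V.a₂ = 5 * c₂)
    (h₃ : V.a₃ = 5 * c₃) (h₄ : V.a₄ = 5 * c₄) (h₆ : V.a₆ = 5 * c₆) (hc₄ : ¬ (5 : ℤ) ∣ c₄ - 2)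
    {x y : ℤ_[5]} (hx : IsUnit x) (hxy : V.toAffine.Equation (x : ℚ_[5]) (y : ℚ_[5])) :
    (V.preΨ' 5).eval (x : ℚ_[5]) ≠ 0 := by
  -- the integral model `V₀/ℤ₅` with `V = V₀ ⊗ ℚ₅`
  set V₀ : WeierstrassCurve ℤ_[5] := ⟨5 * c₁, 5 * c₂, 5 * c₃, 5 * c₄, 5 * c₆⟩ with hV₀
  -- numerals cross the coercion `ℤ₅ → ℚ₅` (no `simp` lemma for `OfNat` literals)
  have c5 : ((5 : ℤ_[5]) : ℚ_[5]) = 5 := by norm_cast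
  have hV : V = V₀.map PadicInt.Coe.ringHom := by
    ext
    · simp [hV₀, h₁, c5]
    · simp [hV₀, h₂, c5]
    · simp [hV₀, h₃, c5]
    · simp [hV₀, h₄, c5]
    · simp [hV₀, h₆, c5]
  -- the curve equation as an identity in `ℤ₅`
  have hEQ := (WeierstrassCurve.Affine.equation_iff ..).1 hxy
  rw [h₁, h₂, h₃, h₄, h₆] at hEQ
  have hE : y ^ 2 + 5 * (c₁ : ℤ_[5]) * x * y + 5 * (c₃ : ℤ_[5]) * y =
      x ^ 3 + 5 * (c₂ : ℤ_[5]) * x ^ 2 + 5 * (c₄ : ℤ_[5]) * x + 5 * (c₆ : ℤ_[5]) := by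
    apply PadicInt.ext
    push_cast
    simp only [c5]
    linear_combination hEQ
  -- the vanishing of `ψ₅`, transported to `ℤ₅`
  intro h0
  have hT : (V₀.preΨ' 5).eval x = 0 := by
    have e : ((V₀.map PadicInt.Coe.ringHom).preΨ' 5).eval (PadicInt.Coe.ringHom x) =
        PadicInt.Coe.ringHom ((V₀.preΨ' 5).eval x) := by
      rw [WeierstrassCurve.map_preΨ', eval_map, eval₂_hom]
    rw [hV] at h0
    have h0' : PadicInt.Coe.ringHom ((V₀.preΨ' 5).eval x) = 0 := by
      rw [← e]
      simpa using h0
    simpa using h0'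
  obtain ⟨G, hG⟩ := exists_eval_preΨ'_five_eq_of_coeff_eq_five_mul V₀ (c₁ := (c₁ : ℤ_[5]))
    (c₂ := (c₂ : ℤ_[5])) (c₃ := (c₃ : ℤ_[5])) (c₄ := (c₄ : ℤ_[5])) (c₆ := (c₆ : ℤ_[5]))
    rfl rfl rfl rfl rfl x
  rw [hG] at hT
  -- reduce modulo `25`
  have twentyfive : (25 : ZMod (5 ^ 2)) = 0 := by decide
  have hz : 5 * PadicInt.toZModPow 2 x ≠ 0 := five_mul_toZModPow_two_ne_zero hx
  have hred := congrArg (PadicInt.toZModPow 2) hT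
  have hEq := congrArg (PadicInt.toZModPow 2) hE
  simp only [map_add, map_mul, map_pow, map_intCast, map_ofNat, map_zero] at hred hEq
  set z := PadicInt.toZModPow 2 x
  set w := PadicInt.toZModPow 2 y
  set g := PadicInt.toZModPow 2 G
  have hw : 5 * (w ^ 2 - z ^ 3) = 0 := by
    linear_combination (5 : ZMod (5 ^ 2)) * hEq +
      ((c₂ : ZMod (5 ^ 2)) * z ^ 2 + (c₄ : ZMod (5 ^ 2)) * z + (c₆ : ZMod (5 ^ 2))
        - (c₁ : ZMod (5 ^ 2)) * z * w - (c₃ : ZMod (5 ^ 2)) * w) * twentyfive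
  obtain ⟨h12, h10⟩ := zmod_25_core z w hw hz
  have hlin : 5 + 10 * (c₄ : ZMod (5 ^ 2)) = 0 := by
    linear_combination hred - h12 - 2 * (c₄ : ZMod (5 ^ 2)) * h10
      - ((c₁ : ZMod (5 ^ 2)) * (c₃ : ZMod (5 ^ 2)) * z ^ 10 + g) * twentyfive
  have h5 : 5 * ((c₄ : ZMod (5 ^ 2)) - 2) = 0 := zmod_25_lin _ hlin
  -- `5·(c̄₄ − 2) = 0` in `ℤ/25ℤ` says `5 ∣ c₄ − 2`
  apply hc₄
  have h25 : ((5 * (c₄ - 2) : ℤ) : ZMod (5 ^ 2)) = 0 := by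
    push_cast
    linear_combination h5
  rw [ZMod.intCast_zmod_eq_zero_iff_dvd] at h25
  norm_num at h25
  omega

/-- **`5 • P ≠ O`** for every point `P = (x, y)` of `E₀(ℚ₅) ∖ E₁(ℚ₅)` (unit `x`, integral `y`) of a
non-exceptional (2.1)-model at `p = 5`: by `[5]P = O ⟺ ΨSq₅(x) = 0`
(`WeierstrassCurve.zsmul_some_eq_zero_iff_eval_ΨSq`), `ΨSq₅ = ψ₅²` (Mathlib `ΨSq_ofNat`), and
`eval_preΨ'_five_ne_zero_of_isUnit_five`.
[cite: KimNakamura2020, Assumption 2.5 and Thm 2.1 (arXiv p. 5)]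
[cite: KostersPannekoek2017, Cor. 2] [cite: SilvermanAEC2009, Exercise 3.7 (f)] -/
theorem five_nsmul_ne_zero_of_isUnit_five (h₁ : V.a₁ = 5 * c₁) (h₂ : V.a₂ = 5 * c₂)
    (h₃ : V.a₃ = 5 * c₃) (h₄ : V.a₄ = 5 * c₄) (h₆ : V.a₆ = 5 * c₆) (hc₄ : ¬ (5 : ℤ) ∣ c₄ - 2)
    {x y : ℤ_[5]} (hx : IsUnit x) (hxy : V.toAffine.Nonsingular (x : ℚ_[5]) (y : ℚ_[5])) :
    5 • (WeierstrassCurve.Affine.Point.some (x : ℚ_[5]) (y : ℚ_[5]) hxy) ≠ 0 := by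
  classical
  intro h5
  have hz : (5 : ℤ) • (WeierstrassCurve.Affine.Point.some (x : ℚ_[5]) (y : ℚ_[5]) hxy) = 0 := by
    rw [show (5 : ℤ) = ((5 : ℕ) : ℤ) by rfl, natCast_zsmul]
    exact h5
  have hΨ := (V.zsmul_some_eq_zero_iff_eval_ΨSq hxy 5).mp hz
  rw [show (5 : ℤ) = ((5 : ℕ) : ℤ) by rfl, WeierstrassCurve.ΨSq_ofNat, if_neg (by decide), mul_one,
    eval_pow] at hΨ
  exact eval_preΨ'_five_ne_zero_of_isUnit_five V h₁ h₂ h₃ h₄ h₆ hc₄ hx hxy.1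
    ((pow_eq_zero_iff two_ne_zero).mp hΨ)

end Local

/-! ## §3 From the fact file's predicate `NonExceptional W 5` -/

/-- Unfolding `NonExceptional` at `p = 5`: only the `a₄`-clause is live.
[cite: KimNakamura2020, Assumption 2.5 (arXiv p. 5)] [cite: KostersPannekoek2017, Cor. 2] -/
theorem nonExceptional_five_iff (W : WeierstrassCurve ℚ) :
    NonExceptional W 5 ↔
      ∃ C : WeierstrassCurve.VariableChange ℚ, C.u = 1 ∧
        ∃ b₁ b₂ b₃ b₄ b₆ : ℤ,
          (C • W).a₁ = (5 : ℚ) * b₁ ∧ (C • W).a₂ = (5 : ℚ) * b₂ ∧ (C • W).a₃ = (5 : ℚ) * b₃ ∧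
            (C • W).a₄ = (5 : ℚ) * b₄ ∧ (C • W).a₆ = (5 : ℚ) * b₆ ∧ ¬ (5 : ℤ) ∣ b₄ - 2 := by
  unfold NonExceptional
  rw [Nat.cast_ofNat]
  constructor
  · rintro ⟨C, hu, b₁, b₂, b₃, b₄, b₆, h₁, h₂, h₃, h₄, h₆, -, -, h5, -⟩
    exact ⟨C, hu, b₁, b₂, b₃, b₄, b₆, h₁, h₂, h₃, h₄, h₆, h5 rfl⟩
  · rintro ⟨C, hu, b₁, b₂, b₃, b₄, b₆, h₁, h₂, h₃, h₄, h₆, h5⟩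
    exact ⟨C, hu, b₁, b₂, b₃, b₄, b₆, h₁, h₂, h₃, h₄, h₆, fun h => absurd h (by norm_num),
      fun h => absurd h (by norm_num), fun _ => h5, fun h => absurd h (by norm_num)⟩

/-- **Certificate constructor for `NonExceptional W 5`.**  To certify that `(E,5)` is not a
Kosters–Pannekoek exceptional case it suffices to exhibit a translation `(r, s, t)` (with `u = 1`)
and integers `bᵢ` such that the translated coefficients — Mathlib's `variableChange_aᵢ` formulas,
`a₁' = a₁ + 2s`, `a₂' = a₂ − s a₁ + 3r − s²`, `a₃' = a₃ + r a₁ + 2t`,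
`a₄' = a₄ − s a₃ + 2r a₂ − (t + rs) a₁ + 3r² − 2st`, `a₆' = a₆ + r a₄ + r² a₂ + r³ − t a₃ − t² − rt a₁`
— are `5 bᵢ` with `b₄ ≢ 2 (mod 5)` (i.e. `a₄' ≢ 10 (mod 25)`); each hypothesis is a closed rational
identity, decidable by `norm_num` on a concrete curve.
[cite: KimNakamura2020, Assumption 2.5 with (2.1) (arXiv p. 5)] [cite: KostersPannekoek2017, Cor. 2] -/
theorem nonExceptional_five_of_translate (W : WeierstrassCurve ℚ) (r s t : ℚ) (b₁ b₂ b₃ b₄ b₆ : ℤ)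
    (h₁ : W.a₁ + 2 * s = 5 * b₁)
    (h₂ : W.a₂ - s * W.a₁ + 3 * r - s ^ 2 = 5 * b₂)
    (h₃ : W.a₃ + r * W.a₁ + 2 * t = 5 * b₃)
    (h₄ : W.a₄ - s * W.a₃ + 2 * r * W.a₂ - (t + r * s) * W.a₁ + 3 * r ^ 2 - 2 * s * t = 5 * b₄)
    (h₆ : W.a₆ + r * W.a₄ + r ^ 2 * W.a₂ + r ^ 3 - t * W.a₃ - t ^ 2 - r * t * W.a₁ = 5 * b₆)
    (hb : ¬ (5 : ℤ) ∣ b₄ - 2) : NonExceptional W 5 := by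
  rw [nonExceptional_five_iff]
  refine ⟨⟨1, r, s, t⟩, rfl, b₁, b₂, b₃, b₄, b₆, ?_, ?_, ?_, ?_, ?_, hb⟩
  · rw [WeierstrassCurve.variableChange_a₁, ← h₁]; simp
  · rw [WeierstrassCurve.variableChange_a₂, ← h₂]; simp
  · rw [WeierstrassCurve.variableChange_a₃, ← h₃]; simp
  · rw [WeierstrassCurve.variableChange_a₄, ← h₄]; simp
  · rw [WeierstrassCurve.variableChange_a₆, ← h₆]; simp

/-- **`NonExceptional W 5` ⟹ a (2.1)-model over `ℚ₅` on which no point of `E₀ ∖ E₁` is killed by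
`5`.** For `W/ℚ`, the predicate of `RankZeroShaBound.lean` supplies a translate `C • W` (`u = 1`, so
the same discriminant and the same minimality) with `aᵢ = 5bᵢ`, `bᵢ ∈ ℤ`, `5 ∤ b₄ − 2`; on its base
change to `ℚ₅`, every point `(x, y)` with `x ∈ ℤ₅ˣ`, `y ∈ ℤ₅` satisfies `5 • (x, y) ≠ O`.
[cite: KimNakamura2020, Assumption 2.5 with (2.1) and Thm 2.1 (arXiv p. 5)]
[cite: KostersPannekoek2017, Cor. 2 (the direction "not exceptional ⇒ no `p`-torsion", at `K = ℚ₅`)] -/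
theorem exists_model_five_nsmul_ne_zero_of_nonExceptional_five (W : WeierstrassCurve ℚ)
    (hNE : NonExceptional W 5) :
    ∃ C : WeierstrassCurve.VariableChange ℚ, C.u = 1 ∧
      ∀ (x y : ℤ_[5]) (hxy : ((C • W).baseChange ℚ_[5]).toAffine.Nonsingular (x : ℚ_[5]) y),
        IsUnit x → 5 • (WeierstrassCurve.Affine.Point.some (x : ℚ_[5]) (y : ℚ_[5]) hxy) ≠ 0 := by
  obtain ⟨C, hu, b₁, b₂, b₃, b₄, b₆, h₁, h₂, h₃, h₄, h₆, h5⟩ := (nonExceptional_five_iff W).1 hNE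
  refine ⟨C, hu, fun x y hxy hx => ?_⟩
  refine five_nsmul_ne_zero_of_isUnit_five ((C • W).baseChange ℚ_[5]) (c₁ := b₁) (c₂ := b₂)
    (c₃ := b₃) (c₄ := b₄) (c₆ := b₆) ?_ ?_ ?_ ?_ ?_ h5 hx hxy
  · simp [WeierstrassCurve.baseChange, h₁]
  · simp [WeierstrassCurve.baseChange, h₂]
  · simp [WeierstrassCurve.baseChange, h₃]
  · simp [WeierstrassCurve.baseChange, h₄]
  · simp [WeierstrassCurve.baseChange, h₆]

end Literature.NumberTheory.EllipticCurves.KimNakamura2020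

end
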